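import Summits.Ventures.HodgeRepro2.T5IsotypicDimensionBound
import Summits.Ventures.HodgeRepro2.T5IsotypicStep4Adelic

/-!
# T5IsotypicDimensionBoundInvariants — STEP 4 + STEP 5: «dim π₀^{K_f}[τ] < ∞» for the irreducible `π₀`

Cell pub-hodge-repro2, seat p5, Tier 5 (route/T5-N4-p5.md, N4.3 v13 (A3) STEPS 4–5, l. 147).
Row 79 places the `ρ`-irreducible `W₀` («π₀», irreducible under the big group) inside exactly one
`A`-isotypic part `L π` («π₀ ⊂ L_{π_∞}»); row 80 bounds the `τ`-isotypic dimension of every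
`ℂ[K]`-submodule of `L π ⊓ Fx = ⨆ S_π` («L_{π_∞} ∩ L^{K_f}»).  This file composes the two on the
subspace `W₀ ⊓ Fx` («π₀^{K_f} = π₀ ∩ L^{K_f}»):

* `inf_stable`, `toKSubmodule`, `exists_mem_toKSubmodule_of_le`: a `K`-stable subspace `W` of `E`
  cuts out a `ℂ[K]`-submodule `W ⊓ ⨆ S_π` of `(sumRep κ hS H π).asModule` (all of `W` when
  `W ≤ ⨆ S_π`), and `W₀ ⊓ Fx` is `K`-stable (`W₀` is `ρ`-stable, `Fx` is the closed span of
  `ρ ∘ ι`-stable subspaces);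
* `inf_le_iSup_members`: `W₀ ≤ L π` ⇒ `W₀ ⊓ Fx ≤ ⨆ S_π` (row 80's `iSup_eq_inf`);
* **`finite_and_finrank_isotypicComponent_inf_le`**: for `W₀` closed, `ρ`-stable, `W₀ ≤ L π`
  (row 79 supplies such a `π` when `W₀` is `ρ`-irreducible and (α) holds) and a simple `ℂ[K]`-module
  `T` with `H_π[T]` finite-dimensional: the `T`-isotypic part of `W₀ ⊓ Fx` is finite-dimensional of
  dimension `≤ #S_π · dim H_π[T]` — «dim π₀^{K_f}[τ] ≤ m_{K_f}(π_∞) · dim (H_{π_∞})_τ < ∞».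

Here `ρ : G →* (E →L[ℂ] E)` is the unitary representation of the big group («G(𝔸)»), `ι : A →* G`
(«G_∞ ⊂ G(𝔸)»), the decomposition `S` of `Fx` and the isotypic parts are those of `ρ ∘ ι`, and
`κ : K →* A` («K_∞ ⊂ G_∞»).  Imports row 80 (and rows 76 / 77′ / 78 / 37 through it).
Axioms: propext, Classical.choice, Quot.sound.  README §8(d): uses an L-value-free non-vanishing
device: NO.
-/

namespace Summit.Ventures.HodgeRepro2.T5IsotypicDimensionBoundInvariants

open scoped InnerProductSpace
open Summit.Ventures.HodgeRepro2.T5CompactDiscreteDecomposition (IrreducibleOn)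
open Summit.Ventures.HodgeRepro2.T5FiniteMultiplicity (IsUnitaryEquiv)
open Summit.Ventures.HodgeRepro2.T5FiniteCopiesModule (toRep)
open Summit.Ventures.HodgeRepro2.T5IsotypicDimensionBound (members sumRep iSup_eq_inf
  finite_and_finrank_isotypicComponent_le)

variable {E : Type*} [NormedAddCommGroup E] [InnerProductSpace ℂ E] [CompleteSpace E]
variable {G A : Type*} [Group G] [Group A]

section Submodule

variable {K : Type*} [Group K]

omit [CompleteSpace E] in
/-- A `K`-stable subspace `W` of `E` contained in `⨆ S_π` is a `ℂ[K]`-submodule of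
`(sumRep κ hS H π).asModule` (the `K`-action being `ρ (κ k)`). -/
def toKSubmodule {ρA : A →* (E →L[ℂ] E)} (κ : K →* A) {S : Set (Submodule ℂ E)}
    (hS : ∀ W ∈ S, IrreducibleOn ρA W) {P : Type*} {ι : P → Type*} (H : ∀ π, ι π → Submodule ℂ E)
    (π : P) (W : Submodule ℂ E) (hW : ∀ k, ∀ x ∈ W, ρA (κ k) x ∈ W) :
    Submodule (MonoidAlgebra ℂ K) (sumRep κ hS H π).asModule where
  carrier := {x | ((sumRep κ hS H π).asModuleEquiv x : E) ∈ W}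
  add_mem' {x y} hx hy := by
    simp only [Set.mem_setOf_eq, map_add, Submodule.coe_add] at hx hy ⊢
    exact W.add_mem hx hy
  zero_mem' := by simp
  smul_mem' a x hx := by
    simp only [Set.mem_setOf_eq] at hx ⊢
    induction a using MonoidAlgebra.induction_linear with
    | zero => simp
    | add a b ha hb =>
      rw [add_smul, map_add, Submodule.coe_add]
      exact W.add_mem ha hb
    | single g c =>
      have h : ((sumRep κ hS H π).asModuleEquiv (MonoidAlgebra.single g c • x) : E) =
          c • ρA (κ g) ((sumRep κ hS H π).asModuleEquiv x : E) := by
        rw [Representation.single_smul]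
        rfl
      rw [h]
      exact W.smul_mem c (hW g _ hx)

omit [CompleteSpace E] in
/-- Membership in `toKSubmodule`. -/
theorem mem_toKSubmodule {ρA : A →* (E →L[ℂ] E)} (κ : K →* A) {S : Set (Submodule ℂ E)}
    (hS : ∀ W ∈ S, IrreducibleOn ρA W) {P : Type*} {ι : P → Type*} (H : ∀ π, ι π → Submodule ℂ E)
    (π : P) (W : Submodule ℂ E) (hW) (x : (sumRep κ hS H π).asModule) :
    x ∈ toKSubmodule κ hS H π W hW ↔ ((sumRep κ hS H π).asModuleEquiv x : E) ∈ W :=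
  Iff.rfl

omit [CompleteSpace E] in
/-- When `W ≤ ⨆ S_π`, every vector of `W` is (the image of) a vector of `toKSubmodule … W`. -/
theorem exists_mem_toKSubmodule_of_le {ρA : A →* (E →L[ℂ] E)} (κ : K →* A)
    {S : Set (Submodule ℂ E)} (hS : ∀ W ∈ S, IrreducibleOn ρA W) {P : Type*} {ι : P → Type*}
    (H : ∀ π, ι π → Submodule ℂ E) (π : P) (W : Submodule ℂ E) (hW)
    (hle : W ≤ ⨆ j : members S H π, (j : Submodule ℂ E)) {x : E} (hx : x ∈ W) :
    ∃ y ∈ toKSubmodule κ hS H π W hW, ((sumRep κ hS H π).asModuleEquiv y : E) = x :=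
  ⟨(sumRep κ hS H π).asModuleEquiv.symm ⟨x, hle hx⟩, by
    rw [mem_toKSubmodule, LinearEquiv.apply_symm_apply]
    exact hx, by rw [LinearEquiv.apply_symm_apply]⟩

omit [CompleteSpace E] in
/-- `W₀ ⊓ Fx` is `K`-stable when `W₀` is `ρ`-stable and `Fx` is the closure of the span of the
`ρ ∘ ι`-stable members of `S`. -/
theorem inf_stable {ρ : G →* (E →L[ℂ] E)} (ι : A →* G) (κ : K →* A)
    {S : Set (Submodule ℂ E)} (hS : ∀ W ∈ S, IrreducibleOn (ρ.comp ι) W) {Fx : Submodule ℂ E}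
    (hSd : (sSup S).topologicalClosure = Fx) {W₀ : Submodule ℂ E}
    (hW₀s : ∀ g, ∀ x ∈ W₀, ρ g x ∈ W₀) (k : K) :
    ∀ x ∈ W₀ ⊓ Fx, (ρ.comp ι) (κ k) x ∈ W₀ ⊓ Fx := by
  intro x hx
  refine ⟨hW₀s _ x hx.1, ?_⟩
  rw [← hSd] at hx ⊢
  have hstab : ∀ y ∈ sSup S, (ρ.comp ι) (κ k) y ∈ sSup S := by
    intro y hy
    rw [sSup_eq_iSup'] at hy ⊢
    refine Submodule.iSup_induction (fun W : S => (W : Submodule ℂ E))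
      (motive := fun y => (ρ.comp ι) (κ k) y ∈ ⨆ W : S, (W : Submodule ℂ E)) hy ?_ ?_ ?_
    · intro W y hy
      exact Submodule.mem_iSup_of_mem W ((hS W W.2).2.1 (κ k) y hy)
    · simp
    · intro y z hy hz
      rw [map_add]
      exact Submodule.add_mem _ hy hz
  exact map_mem_closure ((ρ.comp ι) (κ k)).continuous hx.2 hstab

end Submodule

section Bound

variable {P : Type*} {F : P → Type*} [∀ π, NormedAddCommGroup (F π)]
  [∀ π, InnerProductSpace ℂ (F π)] [∀ π, CompleteSpace (F π)]

/-- `W₀ ≤ L π` ⇒ `W₀ ⊓ Fx ≤ ⨆ S_π` (row 80's `iSup_eq_inf`). -/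
theorem inf_le_iSup_members {ρA : A →* (E →L[ℂ] E)} (hρ : ∀ g, star (ρA g) = ρA g⁻¹)
    (σ : ∀ π, A →* (F π →L[ℂ] F π)) (hσ : ∀ π g, star (σ π g) = σ π g⁻¹)
    (hσirr : ∀ π, ∀ V : Submodule ℂ (F π), IsClosed (V : Set (F π)) →
      (∀ g, ∀ v ∈ V, σ π g v ∈ V) → V = ⊥ ∨ V = ⊤)
    (hne : ∀ π π', π ≠ π' → ∀ V : F π ≃ₗᵢ[ℂ] F π', ¬ ∀ g x, V (σ π g x) = σ π' g (V x))
    {ι : P → Type*} (H : ∀ π, ι π → Submodule ℂ E) (hHc : ∀ π i, IsClosed (H π i : Set E))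
    (hHs : ∀ π i g, ∀ x ∈ H π i, ρA g x ∈ H π i)
    (U : ∀ π i, F π ≃ₗᵢ[ℂ] H π i) (hU : ∀ π i g x, ((U π i) (σ π g x) : E) = ρA g (U π i x))
    (hdense : (⨆ π, (⨆ i, H π i).topologicalClosure).topologicalClosure = ⊤)
    {Fx : Submodule ℂ E} {S : Set (Submodule ℂ E)} (hS : ∀ W ∈ S, IrreducibleOn ρA W)
    (hSo : S.Pairwise (fun W W' => W ⟂ W')) (hSd : (sSup S).topologicalClosure = Fx)
    (hfin : ∀ W₀ ∈ S, {W ∈ S | IsUnitaryEquiv ρA W₀ W}.Finite) (π : P) [Nontrivial (F π)]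
    {W₀ : Submodule ℂ E} (hπ : W₀ ≤ (⨆ i, H π i).topologicalClosure) :
    W₀ ⊓ Fx ≤ ⨆ j : members S H π, (j : Submodule ℂ E) := by
  rw [iSup_eq_inf hρ σ hσ hσirr hne H hHc hHs U hU hdense hS hSo hSd hfin π]
  exact inf_le_inf_right Fx hπ

/-- **STEP 4 + STEP 5: «dim π₀^{K_f}[τ] ≤ m_{K_f}(π_∞) · dim (H_{π_∞})_τ < ∞».**  `ρ` unitary for
the big group `G`, `ι : A →* G`, the `A`-isotypic data and the decomposition `S` of `Fx` for `ρ ∘ ι`,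
`W₀` closed and `ρ`-stable with `W₀ ≤ L π` (row 79 gives such a `π` for a `ρ`-irreducible `W₀` under
(α)), `κ : K →* A` and a simple `ℂ[K]`-module `T` with `H_π[T]` finite-dimensional: the `T`-isotypic
part of `W₀ ⊓ Fx` («π₀^{K_f}»), as a `ℂ[K]`-submodule of `L π ⊓ Fx`, is finite-dimensional of
dimension at most `#S_π · dim_ℂ H_π[T]`. -/
theorem finite_and_finrank_isotypicComponent_inf_le {ρ : G →* (E →L[ℂ] E)}
    (hρ : ∀ g, star (ρ g) = ρ g⁻¹) (ι : A →* G)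
    (σ : ∀ π, A →* (F π →L[ℂ] F π)) (hσ : ∀ π g, star (σ π g) = σ π g⁻¹)
    (hσirr : ∀ π, ∀ V : Submodule ℂ (F π), IsClosed (V : Set (F π)) →
      (∀ g, ∀ v ∈ V, σ π g v ∈ V) → V = ⊥ ∨ V = ⊤)
    (hne : ∀ π π', π ≠ π' → ∀ V : F π ≃ₗᵢ[ℂ] F π', ¬ ∀ g x, V (σ π g x) = σ π' g (V x))
    {ιx : P → Type*} (H : ∀ π, ιx π → Submodule ℂ E) (hHc : ∀ π i, IsClosed (H π i : Set E))
    (hHs : ∀ π i a, ∀ x ∈ H π i, (ρ.comp ι) a x ∈ H π i)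
    (U : ∀ π i, F π ≃ₗᵢ[ℂ] H π i)
    (hU : ∀ π i a x, ((U π i) (σ π a x) : E) = (ρ.comp ι) a (U π i x))
    (hdense : (⨆ π, (⨆ i, H π i).topologicalClosure).topologicalClosure = ⊤)
    {Fx : Submodule ℂ E} {S : Set (Submodule ℂ E)} (hS : ∀ W ∈ S, IrreducibleOn (ρ.comp ι) W)
    (hSo : S.Pairwise (fun W W' => W ⟂ W')) (hSd : (sSup S).topologicalClosure = Fx)
    (hfin : ∀ W₀ ∈ S, {W ∈ S | IsUnitaryEquiv (ρ.comp ι) W₀ W}.Finite) (π : P) [Nontrivial (F π)]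
    {W₀ : Submodule ℂ E} (hW₀s : ∀ g, ∀ x ∈ W₀, ρ g x ∈ W₀)
    (hπ : W₀ ≤ (⨆ i, H π i).topologicalClosure)
    {K : Type*} [Group K] (κ : K →* A)
    (T : Type*) [AddCommGroup T] [Module (MonoidAlgebra ℂ K) T]
    [IsSimpleModule (MonoidAlgebra ℂ K) T]
    [Module.Finite ℂ (isotypicComponent (MonoidAlgebra ℂ K) (toRep ((σ π).comp κ)).asModule T)] :
    (∀ x ∈ W₀ ⊓ Fx, ∃ y ∈ toKSubmodule κ hS H π (W₀ ⊓ Fx) (inf_stable ι κ hS hSd hW₀s),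
      ((sumRep κ hS H π).asModuleEquiv y : E) = x) ∧
    Module.Finite ℂ (isotypicComponent (MonoidAlgebra ℂ K)
      (toKSubmodule κ hS H π (W₀ ⊓ Fx) (inf_stable ι κ hS hSd hW₀s)) T) ∧
    Module.finrank ℂ (isotypicComponent (MonoidAlgebra ℂ K)
      (toKSubmodule κ hS H π (W₀ ⊓ Fx) (inf_stable ι κ hS hSd hW₀s)) T) ≤
      Nat.card (members S H π) *
        Module.finrank ℂ (isotypicComponent (MonoidAlgebra ℂ K) (toRep ((σ π).comp κ)).asModule T) := by
  have hle : W₀ ⊓ Fx ≤ ⨆ j : members S H π, (j : Submodule ℂ E) :=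
    inf_le_iSup_members (ρA := ρ.comp ι) (T5IsotypicStep4Adelic.star_comp_eq hρ ι) σ hσ hσirr hne
      H hHc hHs U hU hdense hS hSo hSd hfin π hπ
  refine ⟨fun x hx => exists_mem_toKSubmodule_of_le κ hS H π (W₀ ⊓ Fx) _ hle hx, ?_⟩
  exact finite_and_finrank_isotypicComponent_le (T5IsotypicStep4Adelic.star_comp_eq hρ ι) σ hσ
    hσirr hne H hHc hHs U hU hdense hS hSo hSd hfin π κ T _

end Bound

end Summit.Ventures.HodgeRepro2.T5IsotypicDimensionBoundInvariants
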